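/-
Copyright: the b2b-balaban T⁴-continuum CRUX team, row NE7b OWNER lineage `t4-ne7b-p1` (gen 145). Project licence.
-/
import Summits.QuantumFields.BalabanUV.T4Continuum.Spine.NE7b.SupWeightedSlotTools

/-!
# TOOLS FOR THE WEIGHTED FOUR-POINT SLOT LETTERS (SCOPING-d17 §D, recipes (ii)–(iv) at order 4).  The weighted slot letters of
# `M₄′` ((655)) sum each of its fifteen terms against the full-graph weight `W = Π_{6 pairs} ϑ` of the four indices with one slot fixed.
# Typed here abstractly (Mathlib + (649) only): (§1) SCALAR ROUTINGS of `W` onto a term's tree — star and path routings onto a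
# Hessian-edge ∕ two `ρ`-edges (powers `3,4,4`), the two crossing routings of the two-point terms (`K4⊗Hk`: crossing power `3`;
# `K3⊗K3`: crossing power `4`), and the six-factor monotonicity for the pure `K4` term; (§2) THE TRIPLE-SUM FACTORISATION `Σ_yΣ_zΣ_t
# K·a_y·b_{yz}·c_{yzt} ≤ K·A·B·C` under row bounds (the free indices summed leaf-first along the tree) and the index permutations needed to
# bring a term's sum into that (or a two-point master's) order; (§3) THE INTERPOLATED TERM pointwise: `√(K·H)∕√(ρ₁ρ₂)·W ≤
# √K·(√H·w_h)·(w₁∕√ρ₁)·(w₂∕√ρ₂)` (row NE7b, node U5c; Mathlib ∕ (649) only; [folklore]).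

Cell `pub-balaban`, sub-cell `t4`, spine estimate NE7b (`T4WeightBudget.RelWeightBound`; the cell's OWN estimate — NOT PRINTED in
[Bałaban 1983–89], NOT PROVED).  Crux-route work under `Spine/NE7b/` by the row OWNER (`t4-ne7b-p1` gen 145, file (661)) under FREEZE
(0)'s crux-prover clause; NOTHING of Bałaban's is named as a Lean object, valued or asserted; no `T4Continuum/Support` leaf typed; no
`def`, no notation; zero `sorry`.  Imports (BY NAME): the OWNER's (649) `…SupWeightedSlotTools` (Mathlib through it).

WHAT IS PROVED ([folklore]): §1 **`route_star34`**, **`route_path34`**, **`route_cross3`**, **`route_cross4`**, `prod6_le`; §2 **`sum3_le`**,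
`sum3_perm_132`, `sum3_perm_213`, `sum3_perm_231`, `sum3_perm_312`; §3 **`interp_pointwise`**; §4 toy.

HONEST (what this is NOT).  Abstract inequalities only; the four weighted slot letters of `M₄′` are the next files; scalar skeleton ((A3),
NC-NE7b-α UNRULED); nothing of Bałaban's asserted.  BY-NAME EFFECT ON THE WALL: NONE.  NE7b NOT PRINTED ∕ NOT PROVED; spine PROVED 0∕9;
rung (B)+1 — the programme's measures remain FINITE-torus statements; NOT the mass gap, NOT Clay.  HONEST DEPENDENCY: continuum YM on T⁴
⇐ BetaPertH ∧ nine spine estimates (0∕9 proved); BetaPertH ⇐ (D1) ∧ (D4) ∧ CAP+tail; G-an2-4 gates asym, D1 and NE2∕3∕4.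
-/

set_option autoImplicit false

noncomputable section

namespace Summit.QuantumFields.BalabanUV.T4Continuum.NE7b.SupWeightedFourPointTools

open Finset Real
open scoped BigOperators

/-! ## §1. Scalar routings of the full-graph weight -/

section Routing

/-- **Star routing onto a Hessian edge and two `ρ`-edges**: edges `a, b, c ≥ 1` at a common vertex, the three non-tree pairs bounded along
their two-edge paths; `W ≤ a³b³c³ ≤ a³·(b⁴c⁴)`. [folklore] -/
theorem route_star34 {a b c p q s : ℝ} (ha : 1 ≤ a) (hb : 1 ≤ b) (hc : 1 ≤ c) (hq : 0 ≤ q) (hs : 0 ≤ s) (hpb : p ≤ a * b)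
    (hqb : q ≤ a * c) (hsb : s ≤ b * c) : a * b * c * p * q * s ≤ a ^ 3 * (b ^ 4 * c ^ 4) := by
  have ha0 : 0 ≤ a := zero_le_one.trans ha
  have hb0 : 0 ≤ b := zero_le_one.trans hb
  have hc0 : 0 ≤ c := zero_le_one.trans hc
  calc a * b * c * p * q * s = (a * b * c) * (p * q * s) := by ring
    _ ≤ (a * b * c) * ((a * b) * (a * c) * (b * c)) :=
        mul_le_mul_of_nonneg_left (mul_le_mul (mul_le_mul hpb hqb hq (mul_nonneg ha0 hb0)) hsb hs
          (mul_nonneg (mul_nonneg ha0 hb0) (mul_nonneg ha0 hc0))) (mul_nonneg (mul_nonneg ha0 hb0) hc0)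
    _ = a ^ 3 * (b ^ 3 * c ^ 3) := by ring
    _ ≤ a ^ 3 * (b ^ 4 * c ^ 4) :=
        mul_le_mul_of_nonneg_left (mul_le_mul (pow_le_pow_right₀ hb (by norm_num)) (pow_le_pow_right₀ hc (by norm_num))
          (pow_nonneg hc0 3) (pow_nonneg hb0 4)) (pow_nonneg ha0 3)

/-- **Path routing onto a Hessian end-edge `a`, middle edge `b`, far edge `c`** (all `≥ 1`): the non-tree pairs bounded along the path;
`W ≤ a³b⁴c³ ≤ a³·(b⁴c⁴)`. [folklore] -/
theorem route_path34 {a b c p q s : ℝ} (ha : 1 ≤ a) (hb : 1 ≤ b) (hc : 1 ≤ c) (hq : 0 ≤ q) (hs : 0 ≤ s) (hpb : p ≤ a * b)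
    (hqb : q ≤ b * c) (hsb : s ≤ a * (b * c)) : a * b * c * p * q * s ≤ a ^ 3 * (b ^ 4 * c ^ 4) := by
  have ha0 : 0 ≤ a := zero_le_one.trans ha
  have hb0 : 0 ≤ b := zero_le_one.trans hb
  have hc0 : 0 ≤ c := zero_le_one.trans hc
  calc a * b * c * p * q * s = (a * b * c) * (p * q * s) := by ring
    _ ≤ (a * b * c) * ((a * b) * (b * c) * (a * (b * c))) :=
        mul_le_mul_of_nonneg_left (mul_le_mul (mul_le_mul hpb hqb hq (mul_nonneg ha0 hb0)) hsb hs
          (mul_nonneg (mul_nonneg ha0 hb0) (mul_nonneg hb0 hc0))) (mul_nonneg (mul_nonneg ha0 hb0) hc0)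
    _ = a ^ 3 * (b ^ 4 * c ^ 3) := by ring
    _ ≤ a ^ 3 * (b ^ 4 * c ^ 4) :=
        mul_le_mul_of_nonneg_left (mul_le_mul_of_nonneg_left (pow_le_pow_right₀ hc (by norm_num)) (pow_nonneg hb0 4)) (pow_nonneg ha0 3)

/-- **Crossing routing, power three** (two-point terms `K4⊗Hk`, either anchoring): crossing edge `a`, group edges `b, c` at the crossing
vertex and `d` opposite, the two other crossing pairs routed through `a`; with `b² ≤ B`, `c² ≤ C`, `d ≤ D` (the group's `ϑ₂`-weights):
`W ≤ a³·(B·C·D)`. [folklore] -/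
theorem route_cross3 {a b c d q₁ q₂ B C D : ℝ} (ha : 0 ≤ a) (hb : 0 ≤ b) (hc : 0 ≤ c) (hd : 0 ≤ d) (hq₂ : 0 ≤ q₂) (hq₁b : q₁ ≤ a * b)
    (hq₂b : q₂ ≤ a * c) (hbB : b ^ 2 ≤ B) (hcC : c ^ 2 ≤ C) (hdD : d ≤ D) :
    a * b * c * d * q₁ * q₂ ≤ a ^ 3 * (B * C * D) := by
  have hB : 0 ≤ B := (sq_nonneg b).trans hbB
  have hC : 0 ≤ C := (sq_nonneg c).trans hcC
  calc a * b * c * d * q₁ * q₂ = (a * b * c * d) * (q₁ * q₂) := by ring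
    _ ≤ (a * b * c * d) * ((a * b) * (a * c)) :=
        mul_le_mul_of_nonneg_left (mul_le_mul hq₁b hq₂b hq₂ (mul_nonneg ha hb)) (mul_nonneg (mul_nonneg (mul_nonneg ha hb) hc) hd)
    _ = a ^ 3 * (b ^ 2 * c ^ 2 * d) := by ring
    _ ≤ a ^ 3 * (B * C * D) :=
        mul_le_mul_of_nonneg_left (mul_le_mul (mul_le_mul hbB hcC (sq_nonneg c) hB) hdD hd (mul_nonneg hB hC)) (pow_nonneg ha 3)

/-- **Crossing routing, power four** (two-point terms `K3⊗K3`): crossing edge `a`, anchor edge `b`, leg edge `c`, the three other crossing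
pairs routed through `a`; with `b³ ≤ B`, `c³ ≤ C`: `W ≤ B·(a⁴·C)`. [folklore] -/
theorem route_cross4 {a b c q₁ q₂ q₃ B C : ℝ} (ha : 0 ≤ a) (hb : 0 ≤ b) (hc : 0 ≤ c) (hq₂ : 0 ≤ q₂) (hq₃ : 0 ≤ q₃) (hq₁b : q₁ ≤ a * b)
    (hq₂b : q₂ ≤ a * c) (hq₃b : q₃ ≤ a * (b * c)) (hbB : b ^ 3 ≤ B) (hcC : c ^ 3 ≤ C) :
    a * b * c * q₁ * q₂ * q₃ ≤ B * (a ^ 4 * C) := by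
  have hB : 0 ≤ B := (pow_nonneg hb 3).trans hbB
  calc a * b * c * q₁ * q₂ * q₃ = (a * b * c) * (q₁ * q₂ * q₃) := by ring
    _ ≤ (a * b * c) * ((a * b) * (a * c) * (a * (b * c))) :=
        mul_le_mul_of_nonneg_left (mul_le_mul (mul_le_mul hq₁b hq₂b hq₂ (mul_nonneg ha hb)) hq₃b hq₃
          (mul_nonneg (mul_nonneg ha hb) (mul_nonneg ha hc))) (mul_nonneg (mul_nonneg ha hb) hc)
    _ = b ^ 3 * (a ^ 4 * c ^ 3) := by ring
    _ ≤ B * (a ^ 4 * C) := mul_le_mul hbB (mul_le_mul_of_nonneg_left hcC (pow_nonneg ha 4)) (by positivity) hB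

/-- **Six-factor monotonicity** (the pure `K4` term: `W ≤ Πϑ₂`). [folklore] -/
theorem prod6_le {a₁ a₂ a₃ a₄ a₅ a₆ b₁ b₂ b₃ b₄ b₅ b₆ : ℝ} (h₁ : a₁ ≤ b₁) (h₂ : a₂ ≤ b₂) (h₃ : a₃ ≤ b₃) (h₄ : a₄ ≤ b₄) (h₅ : a₅ ≤ b₅)
    (h₆ : a₆ ≤ b₆) (ha₁ : 0 ≤ a₁) (ha₂ : 0 ≤ a₂) (ha₃ : 0 ≤ a₃) (ha₄ : 0 ≤ a₄) (ha₅ : 0 ≤ a₅) (ha₆ : 0 ≤ a₆) :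
    a₁ * a₂ * a₃ * a₄ * a₅ * a₆ ≤ b₁ * b₂ * b₃ * b₄ * b₅ * b₆ := by
  have hb₁ : 0 ≤ b₁ := ha₁.trans h₁
  have hb₂ : 0 ≤ b₂ := ha₂.trans h₂
  have hb₃ : 0 ≤ b₃ := ha₃.trans h₃
  have hb₄ : 0 ≤ b₄ := ha₄.trans h₄
  have hb₅ : 0 ≤ b₅ := ha₅.trans h₅
  refine mul_le_mul (mul_le_mul (mul_le_mul (mul_le_mul (mul_le_mul h₁ h₂ ha₂ hb₁) h₃ ha₃ (mul_nonneg hb₁ hb₂)) h₄ ha₄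
    (mul_nonneg (mul_nonneg hb₁ hb₂) hb₃)) h₅ ha₅ (mul_nonneg (mul_nonneg (mul_nonneg hb₁ hb₂) hb₃) hb₄)) h₆ ha₆ ?_
  exact mul_nonneg (mul_nonneg (mul_nonneg (mul_nonneg hb₁ hb₂) hb₃) hb₄) hb₅

end Routing

/-! ## §2. Triple sums: leaf-first factorisation and index permutations -/

section Sums

variable {ι : Type} [Fintype ι]

/-- **LEAF-FIRST FACTORISATION**: `Σ_yΣ_zΣ_t K·a_y·b_{yz}·c_{yzt} ≤ K·(A·(B·C))` when `Σ_y a ≤ A`, `Σ_z b_{yz} ≤ B` for every `y`, and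
`Σ_t c_{yzt} ≤ C` for every `y,z` (nonnegative `a, b`; the indices summed innermost-first along the term's tree). [folklore] -/
theorem sum3_le {K A B C : ℝ} {a : ι → ℝ} {b : ι → ι → ℝ} {c : ι → ι → ι → ℝ} (hK : 0 ≤ K) (ha : ∀ y, 0 ≤ a y) (hb : ∀ y z, 0 ≤ b y z)
    (hB0 : 0 ≤ B) (hC0 : 0 ≤ C) (hA : ∑ y, a y ≤ A) (hB : ∀ y, ∑ z, b y z ≤ B) (hC : ∀ y z, ∑ t, c y z t ≤ C) :
    ∑ y, ∑ z, ∑ t, K * (a y * (b y z * c y z t)) ≤ K * (A * (B * C)) := by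
  calc ∑ y, ∑ z, ∑ t, K * (a y * (b y z * c y z t)) = ∑ y, ∑ z, K * (a y * (b y z * ∑ t, c y z t)) := by
        simp only [mul_sum]
    _ ≤ ∑ y, ∑ z, K * (a y * (b y z * C)) :=
        sum_le_sum fun y _ => sum_le_sum fun z _ =>
          mul_le_mul_of_nonneg_left (mul_le_mul_of_nonneg_left (mul_le_mul_of_nonneg_left (hC y z) (hb y z)) (ha y)) hK
    _ = ∑ y, K * (a y * ((∑ z, b y z) * C)) := by simp only [mul_sum, sum_mul]
    _ ≤ ∑ y, K * (a y * (B * C)) :=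
        sum_le_sum fun y _ => mul_le_mul_of_nonneg_left (mul_le_mul_of_nonneg_left (mul_le_mul_of_nonneg_right (hB y) hC0) (ha y)) hK
    _ = K * ((∑ y, a y) * (B * C)) := by simp only [mul_sum, sum_mul]
    _ ≤ K * (A * (B * C)) := mul_le_mul_of_nonneg_left (mul_le_mul_of_nonneg_right hA (mul_nonneg hB0 hC0)) hK

omit [Fintype ι] in
/-- Index permutation `(1,3,2)`: swap the two inner sums. [folklore] -/
theorem sum3_perm_132 (s : Finset ι) (f : ι → ι → ι → ℝ) :
    ∑ a ∈ s, ∑ b ∈ s, ∑ c ∈ s, f a b c = ∑ a ∈ s, ∑ c ∈ s, ∑ b ∈ s, f a b c :=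
  sum_congr rfl fun _ _ => sum_comm

omit [Fintype ι] in
/-- Index permutation `(2,1,3)`: swap the two outer sums. [folklore] -/
theorem sum3_perm_213 (s : Finset ι) (f : ι → ι → ι → ℝ) :
    ∑ a ∈ s, ∑ b ∈ s, ∑ c ∈ s, f a b c = ∑ b ∈ s, ∑ a ∈ s, ∑ c ∈ s, f a b c :=
  sum_comm

omit [Fintype ι] in
/-- Index permutation `(2,3,1)`: the outer index moved innermost. [folklore] -/
theorem sum3_perm_231 (s : Finset ι) (f : ι → ι → ι → ℝ) :
    ∑ a ∈ s, ∑ b ∈ s, ∑ c ∈ s, f a b c = ∑ b ∈ s, ∑ c ∈ s, ∑ a ∈ s, f a b c := by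
  rw [sum_comm]
  exact sum_congr rfl fun _ _ => sum_comm

omit [Fintype ι] in
/-- Index permutation `(3,1,2)`: the inner index moved outermost. [folklore] -/
theorem sum3_perm_312 (s : Finset ι) (f : ι → ι → ι → ℝ) :
    ∑ a ∈ s, ∑ b ∈ s, ∑ c ∈ s, f a b c = ∑ c ∈ s, ∑ a ∈ s, ∑ b ∈ s, f a b c := by
  rw [sum_congr rfl fun _ _ => sum_comm, sum_comm]

end Sums

/-! ## §3. The interpolated term, pointwise -/

section Interp

/-- **THE INTERPOLATED TERM AGAINST THE ROUTED WEIGHT**: with the radicand split as `K·H` and `W ≤ w_h·(w₁·w₂)` (the routing onto the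
Hessian edge and the two `ρ`-edges), `√(KH)∕√(ρ₁ρ₂)·W ≤ √K·((√H·w_h)·((w₁∕√ρ₁)·(w₂∕√ρ₂)))`. [folklore] -/
theorem interp_pointwise {R K H ρ₁ ρ₂ W wh w₁ w₂ : ℝ} (hR : R = K * H) (hK : 0 ≤ K) (hρ₁ : 0 < ρ₁) (hW : W ≤ wh * (w₁ * w₂)) :
    Real.sqrt R / Real.sqrt (ρ₁ * ρ₂) * W ≤ Real.sqrt K * ((Real.sqrt H * wh) * ((w₁ / Real.sqrt ρ₁) * (w₂ / Real.sqrt ρ₂))) := by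
  rw [hR, Real.sqrt_mul hK, Real.sqrt_mul hρ₁.le]
  calc Real.sqrt K * Real.sqrt H / (Real.sqrt ρ₁ * Real.sqrt ρ₂) * W
      ≤ Real.sqrt K * Real.sqrt H / (Real.sqrt ρ₁ * Real.sqrt ρ₂) * (wh * (w₁ * w₂)) := mul_le_mul_of_nonneg_left hW (by positivity)
    _ = Real.sqrt K * ((Real.sqrt H * wh) * ((w₁ / Real.sqrt ρ₁) * (w₂ / Real.sqrt ρ₂))) := by ring

end Interp

/-! ## §4. Toy -/

/-- Toy (the crossing routing on numbers): `a = b = c = d = 2`, `q₁ = q₂ = 4 ≤ 2·2`: `2⁴·16 = 256 ≤ 2³·(4·4·2) = 256`. -/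
example : (2 : ℝ) * 2 * 2 * 2 * 4 * 4 ≤ 2 ^ 3 * (4 * 4 * 2) := by norm_num

end Summit.QuantumFields.BalabanUV.T4Continuum.NE7b.SupWeightedFourPointTools

end
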